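import Summits.BirchSwinnertonDyer.BirchSwinnertonDyer.Theorems.UniversalToricDescentLayerLocalTorsionDictionary
import Summits.BirchSwinnertonDyer.Rank1Residual.Additive.ZpTowerPlaceCount
import Summits.BirchSwinnertonDyer.Rank1Residual.X11b.LocalPointsPrimaryComponent
import Literature.NumberTheory.EllipticCurves.ZpExtensionUnramifiedProofs
import Literature.NumberTheory.EllipticCurves.LocalKummerMap
import Summits.BirchSwinnertonDyer.BirchSwinnertonDyer.Theorems.UniversalToricDescentRelaxedKummerPairCountStrict
import HarnessLib

/-!
# The local Kummer factors of the relaxed Poitou–Tate count along the `ℤ_p`-tower, in PRODUCT FORM: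
# `#{w ∣ v in K_m} = p^c` and `∏_{w ∣ v} #𝓛_w(E/K_m, p^k) = (#E[p^∞]^{ker(κ|D_v)}[p^k])^{p^c}` for `m ≫ 0`
# (crux ♭T≤ stmt-BirchSwinnertonDyer-23042, line `sigmacongruence`, stub R1 `stub_relaxedImageCount`, brick (e)/(a) LOCAL SIZE — product form)

Width prover `bsd-wall-utd-p1-w2` g3 under lead `bsd-wall-utd-p1` g18 (`--supports stmt-BirchSwinnertonDyer-23042`, helper).
THEOREMS ONLY (no definition, no named fact, no `sorry`). BSD is not proved by any of this.

Setting: `K` a number field, `W/K` elliptic, `p` prime, `κ : Γ_K ↠ ℤ_p` a `ℤ_p`-extension with layers `K_m = κ.layer m`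
(`Γ_m = κ.layerSubgroup m`), `v ∤ p` a finite place of `K` with decomposition group `D_v = decomp v` FINITELY DECOMPOSED in `K_∞`
with the EXACT INDEX `κ(D_v) = p^c ℤ_p` — recorded, as in the registered stub R1, by `d₁ ∈ D_v` with `κ d₁ = p^c` and `p^c ∣ κ d`
for all `d ∈ D_v` (`UniversalToricDescentSigmaLocalStabilizer.exists_pow_and_forall_dvd_of_not_le`). The lead's relaxed count road
(memo `Cruxes/DefectTransportModThreePT/Lines/sigmacongruence-relaxed-count-road.md` §2 (a),(e),(f)) runs ONE relative Poitou–Tate count over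
`K_m` whose right-hand side is `∏_{w ∈ V_m} #𝓛_w` over the places `V_m` of `K_m` above `v`
(`UniversalToricDescentRelaxedKummerPairCount.natCard_relaxedQuotient_mul_natCard_strictQuotient_eq`), `𝓛_w` the local `p^k`-Kummer
condition of `E/K_m` at `w`. This file evaluates that right-hand side in the `Γ_K`-currency of the line's stubs:

* §1 `exists_isUnit_toAdd_frob_eq` — `κ(Frob_v) = p^c · unit` for any arithmetic Frobenius at the prime `𝔓₀` of `\bar ℤ_K` cut out by the
  chosen embedding `K̄ → K̄_v`: `p^c ∣ κ(Frob)` since `Frob ∈ D_{𝔓₀} = D_v`; conversely `d₁ = Frobⁿ · i · u` with `i ∈ I_{𝔓₀} ≤ ker κ`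
  (a `ℤ_p`-extension is unramified outside `p`, `inertia_le_kerSubgroup_holds`) and `u ∈ Γ_{c+1}` (tree `G_𝔓 = ⟨φ⟩ · I_𝔓 · U`,
  `exists_eq_frobenius_pow_mul_of_mem_decompositionSubgroup`), so `p^c ≡ n κ(Frob) (mod p^{c+1})`.
* §1 `natCard_placesOver_layer_eq_pow` — hence **`#{w ∣ v in K_m} = p^c` for `m ≥ c`** (`ZpTower.card_placesOver_layer_mul_pow_eq`:
  `#{w ∣ v} · p^{m − c} = p^m`), and `card_eq_pow_of_forall_mem_iff` for a finset `V` with `w ∈ V ↔ w ∣ v`.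
* §2 `natCard_kummerSelmerStructure_inr_layer_eq` — for EVERY `m` and every `w ∣ v` of `K_m`:
  `#𝓛_w(E/K_m, p^k) = #E[p^k]^{D_v ⊓ Γ_m}` (`#𝓛_w = #E(K_{m,w})[p^k] · #(𝓞_w/p^k)`, Milne I 3.3 = tree `natCard_kummerSelmerStructure_inr`;
  `#(𝓞_w/p^k) = 1` as `w ∤ p`; the local torsion dictionary `natCard_ker_nsmul_adicCompletion_layer_eq` of width seat g2); and
  `exists_forall_natCard_kummerSelmerStructure_inr_layer_eq_kerD` — for `m ≥ m₀(k)`: `= #{a ∈ E[p^∞] : ker(κ|D_v)-fixed, p^k a = 0}`.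
* §3 `exists_forall_prod_natCard_kummerSelmerStructure_inr_layer_eq` — **for `m ≥ m₀(k, c)` and every finset `V` of places of `K_m` with
  `w ∈ V ↔ w ∣ v`: `∏_{w ∈ V} #𝓛_w(E/K_m, p^k) = (#{a ∈ E[p^∞] : ker(κ|D_v)-fixed, p^k a = 0})^{p^c}`** — the right-hand side of the
  lead's pair count at `L = K_m` in the currency of R3 `stub_localTorsionCountAtTame` / R1 `stub_relaxedImageCount`.

* §4–§5 (appended, same seat) THE PAIR COUNT IN TUPLE CURRENCY: with the lead's relaxed Poitou–Tate pair count
  `natCard_relaxedQuotient_mul_natCard_strictQuotient_eq` at the layer (`KO`/`KS` the relaxed/strict `p^k`-Kummer Selmer groups of `E/K_m`,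
  `T` disjoint from `V`, all infinite places of `K` complex, the Poitou–Tate fact at `K_m`):
  `exists_forall_pow_natCard_fixed_torsion_eq_pairCount` — `(#A^{kerD}[p^k])^{p^c} = #(KO_m(T∪V∪∞)/KO_m(T∪∞)) · #(KS_m(T∪∞)/KS_m(T∪V∪∞))`
  for `m ≥ m₀(k,c)`; and with R3 `stub_localTorsionCountAtTame` (hypothesis `hR3`, registered shape) and
  `natCard_fun_torsion_eq_pow` (`#tuples = (#H¹(kerD,A)[p^k])^{p^c}`):
  **`exists_forall_natCard_tuples_le_pairCount` — `#{θ : Fin p^c → H¹(kerD, A) // p^k • θ = 0} ≤ #(KO_m(T∪V∪∞)/KO_m(T∪∞)) · #(KS_m(T∪∞)/KS_m(T∪V∪∞))`**,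
  the left-hand end of step (f): it remains to bound the two indices by the image count (c) and the dual term (d).
* §6 the finsets `V_m` (places of `K_m` above `v`) and `T_m` (places above a finite set `S`) exist and are disjoint when `v ∉ S`
  (`exists_finset_forall_mem_iff_under_eq`, `exists_finset_forall_mem_iff_under_mem`, `disjoint_of_forall_mem_iff`).

References: [Washington1997] §13.1 (decomposition of tame primes in `ℤ_p`-extensions), Prop. 13.2; [NeukirchANT1999] I §9 Prop. (9.4),
II §8–§9; [MilneADT2006] I §3 Lemma 3.3, Thm. 4.10; [Howard2004HeegnerKolyvagin] Thm. 2.1.11; [GreenbergVatsal2000] §2 pp. 22–25;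
[GreenbergLNM1716] §1 (p. 60), §2 (pp. 62–63).
-/

-- `…BirchSwinnertonDyer.BirchSwinnertonDyer…` is the problem's mandated namespace (D-0017 nested layout)
set_option linter.dupNamespace false
set_option autoImplicit false

noncomputable section
open scoped Classical
open Field NumberField IsDedekindDomain Function WeierstrassCurve
open Literature.NumberTheory.EllipticCurves Literature.NumberTheory.EllipticCurves.GreenbergSelmer
open Literature.NumberTheory.GaloisRepresentations

namespace Summit.BirchSwinnertonDyer.BirchSwinnertonDyer.Theorems.UniversalToricDescentLayerKummerProduct

open Summit.BirchSwinnertonDyer.Rank1Residual.Additive Summit.BirchSwinnertonDyer.Rank1Residual.Additive.ZpTower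
  Summit.BirchSwinnertonDyer.Rank1Residual.X11b.AcSelmer Summit.BirchSwinnertonDyer.Rank1Residual.X11b.Coinv
  Summit.BirchSwinnertonDyer.BirchSwinnertonDyer.Theorems.UniversalToricDescentLayerLocalTorsionDictionary

variable {K : Type} [Field K] [NumberField K] {p : ℕ} [Fact p.Prime] (κ : ZpExtension K p) (v : HeightOneSpectrum (𝓞 K))

/-! ## §1 `κ(Frob_v) = p^c · unit` and the place count `#{w ∣ v in K_m} = p^c` -/

/-- **`κ(Frob_v) = p^c · unit`** at a place `v ∤ p` with exact index `κ(D_v) = p^c ℤ_p` (`d₁ ∈ D_v`, `κ d₁ = p^c`; `p^c ∣ κ d` on `D_v`),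
for every arithmetic Frobenius `φ` at the prime `𝔓₀ = adicCompletionPrime K v`: `φ ∈ D_{𝔓₀} = D_v` gives `p^c ∣ κ φ`, and
`d₁ = φⁿ · i · u` with `i ∈ I_{𝔓₀} ≤ ker κ`, `u ∈ Γ_{c+1}` gives `p^c ≡ n · κ φ (mod p^{c+1})`, so `κ φ / p^c` is a unit.
[cite: Washington1997, §13.1 and Prop. 13.2] [cite: NeukirchANT1999, Ch. I §9 Prop. (9.4)] -/
theorem exists_isUnit_toAdd_frob_eq (hpv : ((p : ℕ) : 𝓞 K) ∉ v.asIdeal) {φ : absoluteGaloisGroup K}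
    (hφ : IsArithFrobAt (𝓞 K) φ (adicCompletionPrime K v)) {c : ℕ}
    (d₁ : decomp (K := K) v) (hd₁ : (κ (d₁ : absoluteGaloisGroup K)).toAdd = (p : ℤ_[p]) ^ c)
    (hdiv : ∀ d : decomp (K := K) v, (p : ℤ_[p]) ^ c ∣ (κ (d : absoluteGaloisGroup K)).toAdd) :
    ∃ u : ℤ_[p], IsUnit u ∧ (κ φ).toAdd = (p : ℤ_[p]) ^ c * u := by
  have hp : p.Prime := Fact.out
  have hDeq : decomp (K := K) v = (adicCompletionPrime K v).decompositionSubgroup (absoluteGaloisGroup K) :=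
    (decompositionSubgroup_adicCompletionPrime_eq_range K v).symm
  haveI := (adicCompletionPrime_isMaximal K v).isPrime
  -- `φ ∈ D_v`, so `p^c ∣ κ φ`
  have hφD : φ ∈ decomp (K := K) v := by rw [hDeq]; exact hφ.mem_stabilizer
  obtain ⟨y, hy⟩ := hdiv ⟨φ, hφD⟩
  refine ⟨y, ?_, hy⟩
  -- `d₁ = φⁿ · i · u`, `i` inertial, `u ∈ Γ_{c+1}`
  have hd₁D : (d₁ : absoluteGaloisGroup K) ∈ (adicCompletionPrime K v).decompositionSubgroup (absoluteGaloisGroup K) := by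
    rw [← hDeq]; exact d₁.2
  obtain ⟨n, i, u, hi, hu, hdeq⟩ := exists_eq_frobenius_pow_mul_of_mem_decompositionSubgroup
    (adicCompletionPrime_mem_primesAbove K v) hφ (κ.isOpen_layerSubgroup (c + 1)) hd₁D
  have hκi : κ i = 1 := ZpExtension.mem_kerSubgroup.mp
    (ZpExtension.inertia_le_kerSubgroup_holds K p κ hpv (adicCompletionPrime_mem_primesAbove K v) hi)
  obtain ⟨z, hz⟩ := ZpExtension.mem_layerSubgroup.mp hu
  -- `p^c = n • κ φ + κ u`
  have key : (p : ℤ_[p]) ^ c = n • ((p : ℤ_[p]) ^ c * y) + (p : ℤ_[p]) ^ (c + 1) * z := by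
    have h := congrArg (fun g : absoluteGaloisGroup K ↦ (κ g).toAdd) hdeq
    simp only [map_mul, map_pow, toAdd_mul, toAdd_pow, hκi, toAdd_one, add_zero] at h
    have hy' : (κ φ).toAdd = (p : ℤ_[p]) ^ c * y := hy
    rw [hd₁, hz, hy'] at h
    exact h
  -- cancel `p^c`: `1 = n y + p z`
  have hpc : ((p : ℤ_[p]) ^ c) ≠ 0 := pow_ne_zero c (by exact_mod_cast hp.ne_zero)
  have h1 : (1 : ℤ_[p]) = n * y + p * z := by
    have h2 : (p : ℤ_[p]) ^ c * 1 = (p : ℤ_[p]) ^ c * (n * y + p * z) := by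
      rw [mul_one]
      conv_lhs => rw [key]
      rw [nsmul_eq_mul]
      ring
    exact mul_left_cancel₀ hpc h2
  -- if `y` were not a unit, `p ∣ y`, so `p ∣ 1`
  by_contra hyu
  have hymem : y ∈ IsLocalRing.maximalIdeal ℤ_[p] := hyu
  rw [PadicInt.maximalIdeal_eq_span_p, Ideal.mem_span_singleton] at hymem
  obtain ⟨t, rfl⟩ := hymem
  apply PadicInt.p_nonunit (p := p)
  refine isUnit_of_dvd_one ⟨n * t + z, ?_⟩
  rw [h1]; ring

/-- **`#{w ∣ v in K_m} = p^c` for `m ≥ c`**: the number of places of the layer `K_m = κ.layer m` above a place `v ∤ p` with exact index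
`κ(D_v) = p^c ℤ_p` is `p^c` — the tree's `#{w ∣ v in K_m} · p^{m − c'} = p^m` (`ZpTower.card_placesOver_layer_mul_pow_eq`, `v` unramified
in `K_∞` by `inertia_le_kerSubgroup_holds`) with `c' = v_p(κ(Frob_v)) = c` (§1). These `p^c` places are the places of `K_∞` above `v`.
[cite: Washington1997, §13.1 and Prop. 13.2] [cite: NeukirchANT1999, Ch. I §9 Prop. (9.4)] [cite: GreenbergLNM1716, §1 (p. 60)] -/
theorem natCard_placesOver_layer_eq_pow (hpv : ((p : ℕ) : 𝓞 K) ∉ v.asIdeal) {c : ℕ}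
    (d₁ : decomp (K := K) v) (hd₁ : (κ (d₁ : absoluteGaloisGroup K)).toAdd = (p : ℤ_[p]) ^ c)
    (hdiv : ∀ d : decomp (K := K) v, (p : ℤ_[p]) ^ c ∣ (κ (d : absoluteGaloisGroup K)).toAdd)
    (m : ℕ) (hm : c ≤ m) :
    Nat.card {w : HeightOneSpectrum (𝓞 (κ.layer m)) // w.under (𝓞 K) = v} = p ^ c := by
  have hp : p.Prime := Fact.out
  obtain ⟨φ, hφ⟩ := HeightOneSpectrum.exists_isArithFrobAt_of_mem_primesAbove_holds (K := K) (v := v)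
    (adicCompletionPrime_mem_primesAbove K v)
  obtain ⟨u, hu, hφu⟩ := exists_isUnit_toAdd_frob_eq κ v hpv hφ d₁ hd₁ hdiv
  have h := card_placesOver_layer_mul_pow_eq κ m (adicCompletionPrime_mem_primesAbove K v)
    (ZpExtension.inertia_le_kerSubgroup_holds K p κ hpv (adicCompletionPrime_mem_primesAbove K v)) hφ hu hφu
  have hpm : p ^ m = p ^ c * p ^ (m - c) := by rw [← pow_add, Nat.add_sub_cancel' hm]
  rw [hpm] at h
  exact Nat.eq_of_mul_eq_mul_right (Nat.pos_of_ne_zero (pow_ne_zero _ hp.ne_zero)) h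

/-- Finset form of the place count: a finset `V` of places of `K_m` with `w ∈ V ↔ w ∣ v` has `p^c` elements (`m ≥ c`).
[cite: Washington1997, §13.1] -/
theorem card_eq_pow_of_forall_mem_iff (hpv : ((p : ℕ) : 𝓞 K) ∉ v.asIdeal) {c : ℕ}
    (d₁ : decomp (K := K) v) (hd₁ : (κ (d₁ : absoluteGaloisGroup K)).toAdd = (p : ℤ_[p]) ^ c)
    (hdiv : ∀ d : decomp (K := K) v, (p : ℤ_[p]) ^ c ∣ (κ (d : absoluteGaloisGroup K)).toAdd)
    (m : ℕ) (hm : c ≤ m) (V : Finset (HeightOneSpectrum (𝓞 (κ.layer m))))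
    (hV : ∀ w, w ∈ V ↔ w.under (𝓞 K) = v) :
    V.card = p ^ c := by
  rw [← natCard_placesOver_layer_eq_pow κ v hpv d₁ hd₁ hdiv m hm, ← Nat.card_eq_finsetCard]
  exact Nat.card_congr (Equiv.subtypeEquivRight fun w ↦ hV w)

/-! ## §2 One place: `#𝓛_w(E/K_m, p^k) = #E[p^k]^{D_v ⊓ Γ_m}` and, for `m ≫ 0`, `= #E[p^∞]^{ker(κ|D_v)}[p^k]` -/

variable (W : WeierstrassCurve K) [W.IsElliptic] (p)

omit [NumberField K] [Fact p.Prime] in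
/-- `#(𝓞_w / p^k 𝓞_w) = 1` at a place `w` of an extension `L ⊇ K` above `v ∤ p`. [folklore] -/
theorem natCard_quotient_span_pow_eq_one {L : Type} [Field L] [NumberField L] [Algebra K L]
    (hpv : ((p : ℕ) : 𝓞 K) ∉ v.asIdeal) (w : HeightOneSpectrum (𝓞 L)) (hw : w.under (𝓞 K) = v) (k : ℕ) :
    Nat.card (w.adicCompletionIntegers L ⧸ Ideal.span {((p ^ k : ℕ) : w.adicCompletionIntegers L)}) = 1 := by
  have hnw : ((p ^ k : ℕ) : 𝓞 L) ∉ w.asIdeal := by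
    intro hmem
    rw [Nat.cast_pow] at hmem
    have hpw : ((p : ℕ) : 𝓞 L) ∈ w.asIdeal := w.isPrime.mem_of_pow_mem k hmem
    apply hpv
    have huv : (w.under (𝓞 K)).asIdeal = v.asIdeal := congrArg HeightOneSpectrum.asIdeal hw
    rw [← huv]
    change ((p : ℕ) : 𝓞 K) ∈ Ideal.comap (algebraMap (𝓞 K) (𝓞 L)) w.asIdeal
    rw [Ideal.mem_comap, map_natCast]
    exact hpw
  have hu : IsUnit ((p ^ k : ℕ) : w.adicCompletionIntegers L) := by
    have h := HeightOneSpectrum.isUnit_algebraMap_adicCompletionIntegers L w hnw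
    rwa [map_natCast] at h
  exact natCard_quotient_span_singleton_eq_one_of_isUnit hu

/-- **`#𝓛_w(E/K_m, p^k) = #E[p^k]^{D_v ⊓ Γ_m}` for EVERY layer `m` and every place `w ∣ v` of `K_m`** (`v ∤ p`): the local `p^k`-Kummer
condition of `E/K_m` at `w` has `#E(K_{m,w})[p^k] · #(𝓞_w/p^k)` elements (Milne I 3.3), the second factor is `1`, and the first is
`#E[p^k]^{D_v ⊓ Γ_m}` by the local torsion dictionary. [cite: MilneADT2006, I §3 Lemma 3.3] [cite: GreenbergLNM1716, §2 (pp. 62–63)] -/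
theorem natCard_kummerSelmerStructure_inr_layer_eq (hpv : ((p : ℕ) : 𝓞 K) ∉ v.asIdeal) (m k : ℕ)
    (w : HeightOneSpectrum (𝓞 (κ.layer m))) (hw : w.under (𝓞 K) = v) :
    Nat.card ((W.baseChange (κ.layer m)).kummerSelmerStructure ((p ^ k : ℕ) : ℤ) (Sum.inr w)) =
      Nat.card {P : W.geomTorsion ((p ^ k : ℕ) : ℤ) // ∀ g ∈ decomp (K := K) v ⊓ κ.layerSubgroup m, g • P = P} := by
  have hp : p.Prime := Fact.out
  have hn : p ^ k ≠ 0 := pow_ne_zero k hp.ne_zero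
  haveI : w.asIdeal.LiesOver v.asIdeal := ⟨(congrArg HeightOneSpectrum.asIdeal hw).symm⟩
  rw [(W.baseChange (κ.layer m)).natCard_kummerSelmerStructure_inr w hn,
    natCard_quotient_span_pow_eq_one p v hpv w hw k, mul_one]
  exact natCard_ker_nsmul_adicCompletion_layer_eq W p κ v m hn w

/-- **`#𝓛_w(E/K_m, p^k) = #{a ∈ E[p^∞] : ker(κ|D_v)-fixed, p^k a = 0}` for `m ≥ m₀(k)` and every `w ∣ v` of `K_m`** — §2 with the deep-layer
dictionary `exists_forall_natCard_ker_nsmul_adicCompletion_layer_eq_kerD` (compactness of `D_v` on the finite `E[p^k]`); the right-hand side is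
that of R3 `stub_localTorsionCountAtTame`. [cite: MilneADT2006, I §3 Lemma 3.3] [cite: Washington1997, §13.1]
[cite: GreenbergVatsal2000, §2 Prop. (2.4) and proof (arXiv p. 22)] -/
theorem exists_forall_natCard_kummerSelmerStructure_inr_layer_eq_kerD (hpv : ((p : ℕ) : 𝓞 K) ∉ v.asIdeal) (k : ℕ) :
    ∃ m₀ : ℕ, ∀ m : ℕ, m₀ ≤ m → ∀ (w : HeightOneSpectrum (𝓞 (κ.layer m))), w.under (𝓞 K) = v →
      Nat.card ((W.baseChange (κ.layer m)).kummerSelmerStructure ((p ^ k : ℕ) : ℤ) (Sum.inr w)) =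
        Nat.card {a : W.geomPrimaryTorsion p //
          (∀ g : kerD κ v, ((g : decomp (K := K) v) : absoluteGaloisGroup K) • a = a) ∧ p ^ k • a = 0} := by
  have hp : p.Prime := Fact.out
  have hn : p ^ k ≠ 0 := pow_ne_zero k hp.ne_zero
  obtain ⟨m₀, hm₀⟩ := exists_forall_natCard_ker_nsmul_adicCompletion_layer_eq_kerD W p κ v k
  refine ⟨m₀, fun m hm w hw ↦ ?_⟩
  have hlo : w.asIdeal.LiesOver v.asIdeal := ⟨(congrArg HeightOneSpectrum.asIdeal hw).symm⟩
  rw [(W.baseChange (κ.layer m)).natCard_kummerSelmerStructure_inr w hn,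
    natCard_quotient_span_pow_eq_one p v hpv w hw k, mul_one]
  exact hm₀ m hm w hlo

/-! ## §3 The product over the places above `v` -/

/-- **PRODUCT FORM of the local size (memo §2 (a),(e),(f))**: at a place `v ∤ p` with exact index `κ(D_v) = p^c ℤ_p` there is
`m₀ = m₀(k, c)` such that for every layer `m ≥ m₀` and every finset `V` of places of `K_m` with `w ∈ V ↔ w ∣ v`:
`∏_{w ∈ V} #𝓛_w(E/K_m, p^k) = (#{a ∈ E[p^∞] : ker(κ|D_v)-fixed, p^k a = 0})^{p^c}` — `p^c` equal factors (§1, §2). This is the right-hand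
side of the relaxed Poitou–Tate pair count `natCard_relaxedQuotient_mul_natCard_strictQuotient_eq` at `L = K_m`, `V = V_m`, in the
currency of the line's stubs R1/R3. [cite: MilneADT2006, I §3 Lemma 3.3] [cite: Washington1997, §13.1] [cite: GreenbergVatsal2000, §2 pp. 22–24] -/
theorem exists_forall_prod_natCard_kummerSelmerStructure_inr_layer_eq (hpv : ((p : ℕ) : 𝓞 K) ∉ v.asIdeal) {c : ℕ}
    (d₁ : decomp (K := K) v) (hd₁ : (κ (d₁ : absoluteGaloisGroup K)).toAdd = (p : ℤ_[p]) ^ c)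
    (hdiv : ∀ d : decomp (K := K) v, (p : ℤ_[p]) ^ c ∣ (κ (d : absoluteGaloisGroup K)).toAdd) (k : ℕ) :
    ∃ m₀ : ℕ, ∀ m : ℕ, m₀ ≤ m → ∀ (V : Finset (HeightOneSpectrum (𝓞 (κ.layer m)))),
      (∀ w, w ∈ V ↔ w.under (𝓞 K) = v) →
      ∏ w ∈ V, Nat.card ((W.baseChange (κ.layer m)).kummerSelmerStructure ((p ^ k : ℕ) : ℤ) (Sum.inr w)) =
        Nat.card {a : W.geomPrimaryTorsion p //
          (∀ g : kerD κ v, ((g : decomp (K := K) v) : absoluteGaloisGroup K) • a = a) ∧ p ^ k • a = 0} ^ (p ^ c) := by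
  obtain ⟨m₀, hm₀⟩ := exists_forall_natCard_kummerSelmerStructure_inr_layer_eq_kerD p κ v W hpv k
  refine ⟨max m₀ c, fun m hm V hV ↦ ?_⟩
  rw [Finset.prod_congr rfl fun w hw ↦ hm₀ m (le_of_max_le_left hm) w ((hV w).mp hw), Finset.prod_const,
    card_eq_pow_of_forall_mem_iff κ v hpv d₁ hd₁ hdiv m (le_of_max_le_right hm) V hV]

/-- The same with the PLACE COUNT recorded alongside (for consumers that also need `#V = p^c`, e.g. the tuple reduction of step (f)).
[cite: Washington1997, §13.1] [cite: MilneADT2006, I §3 Lemma 3.3] -/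
theorem exists_forall_card_and_prod_natCard_kummerSelmerStructure_inr_layer_eq (hpv : ((p : ℕ) : 𝓞 K) ∉ v.asIdeal) {c : ℕ}
    (d₁ : decomp (K := K) v) (hd₁ : (κ (d₁ : absoluteGaloisGroup K)).toAdd = (p : ℤ_[p]) ^ c)
    (hdiv : ∀ d : decomp (K := K) v, (p : ℤ_[p]) ^ c ∣ (κ (d : absoluteGaloisGroup K)).toAdd) (k : ℕ) :
    ∃ m₀ : ℕ, ∀ m : ℕ, m₀ ≤ m → ∀ (V : Finset (HeightOneSpectrum (𝓞 (κ.layer m)))),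
      (∀ w, w ∈ V ↔ w.under (𝓞 K) = v) →
      V.card = p ^ c ∧
      (∀ w ∈ V, Nat.card ((W.baseChange (κ.layer m)).kummerSelmerStructure ((p ^ k : ℕ) : ℤ) (Sum.inr w)) =
        Nat.card {a : W.geomPrimaryTorsion p //
          (∀ g : kerD κ v, ((g : decomp (K := K) v) : absoluteGaloisGroup K) • a = a) ∧ p ^ k • a = 0}) ∧
      ∏ w ∈ V, Nat.card ((W.baseChange (κ.layer m)).kummerSelmerStructure ((p ^ k : ℕ) : ℤ) (Sum.inr w)) =
        Nat.card {a : W.geomPrimaryTorsion p //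
          (∀ g : kerD κ v, ((g : decomp (K := K) v) : absoluteGaloisGroup K) • a = a) ∧ p ^ k • a = 0} ^ (p ^ c) := by
  obtain ⟨m₀, hm₀⟩ := exists_forall_natCard_kummerSelmerStructure_inr_layer_eq_kerD p κ v W hpv k
  refine ⟨max m₀ c, fun m hm V hV ↦ ?_⟩
  have hcard := card_eq_pow_of_forall_mem_iff κ v hpv d₁ hd₁ hdiv m (le_of_max_le_right hm) V hV
  have hfac : ∀ w ∈ V, Nat.card ((W.baseChange (κ.layer m)).kummerSelmerStructure ((p ^ k : ℕ) : ℤ) (Sum.inr w)) =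
      Nat.card {a : W.geomPrimaryTorsion p //
        (∀ g : kerD κ v, ((g : decomp (K := K) v) : absoluteGaloisGroup K) • a = a) ∧ p ^ k • a = 0} :=
    fun w hw ↦ hm₀ m (le_of_max_le_left hm) w ((hV w).mp hw)
  refine ⟨hcard, hfac, ?_⟩
  rw [Finset.prod_congr rfl hfac, Finset.prod_const, hcard]

section PairCount

open Literature.NumberTheory.GaloisCohomology Summit.BirchSwinnertonDyer.Rank1Residual.X11b.KummerPT
  Summit.BirchSwinnertonDyer.Rank1Residual.X11b.Relaxation
  Summit.BirchSwinnertonDyer.BirchSwinnertonDyer.Theorems.UniversalToricDescentRelaxedKummerPairCount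

/-! ## §4 Tuples are torsion coordinatewise; layers are totally complex -/

/-- The layers `K_m` of a `ℤ_p`-extension of a field all of whose infinite places are complex have only complex infinite places
(a real place restricts to a real place). [folklore] -/
theorem isComplex_infinitePlace_layer {K : Type} [Field K] {p : ℕ} [Fact p.Prime] (κ : ZpExtension K p)
    (hK : ∀ w₀ : InfinitePlace K, w₀.IsComplex) (m : ℕ) (w : InfinitePlace (κ.layer m)) : w.IsComplex :=
  InfinitePlace.IsComplex.of_comap (algebraMap K (κ.layer m)) (hK _)

/-- `#{θ : Fin N → B // n • θ = 0} = (#{b : B // n • b = 0})^N`: a tuple is killed by `n` iff every coordinate is. [folklore] -/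
theorem natCard_fun_torsion_eq_pow {B : Type*} [AddMonoid B] (N n : ℕ) :
    Nat.card {θ : Fin N → B // n • θ = 0} = Nat.card {b : B // n • b = 0} ^ N := by
  have e : {θ : Fin N → B // n • θ = 0} ≃ (Fin N → {b : B // n • b = 0}) :=
    { toFun := fun θ i ↦ ⟨θ.1 i, by
        have h := congrFun θ.2 i
        rwa [Pi.smul_apply, Pi.zero_apply] at h⟩
      invFun := fun f ↦ ⟨fun i ↦ (f i).1, funext fun i ↦ by rw [Pi.smul_apply, Pi.zero_apply]; exact (f i).2⟩
      left_inv := fun _ ↦ rfl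
      right_inv := fun _ ↦ rfl }
  rw [Nat.card_congr e, Nat.card_fun, Nat.card_eq_fintype_card (α := Fin N), Fintype.card_fin]

/-! ## §5 The pair count in `Γ_K`-currency -/

/-- **`(#A^{kerD}[p^k])^{p^c} = #(KO_m(T∪V∪∞)/KO_m(T∪∞)) · #(KS_m(T∪∞)/KS_m(T∪V∪∞))`** for `m ≥ m₀(k, c)`, every finset `V` of places of
`K_m` with `w ∈ V ↔ w ∣ v` and every finset `T` disjoint from `V` (`k ≥ 1`, all infinite places of `K` complex, the Poitou–Tate fact at the
layer): the lead's relaxed pair count with its right-hand side `∏_{w∈V} #𝓛_w` evaluated by `…LayerKummerProduct`.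
[cite: MilneADT2006, Ch. I, Thm. 4.10 and Lemma 3.3] [cite: Howard2004HeegnerKolyvagin, Thm. 2.1.11 (arXiv:1202.6340 p. 6)]
[cite: Washington1997, §13.1] -/
theorem exists_forall_pow_natCard_fixed_torsion_eq_pairCount (hpv : ((p : ℕ) : 𝓞 K) ∉ v.asIdeal) {c : ℕ}
    (d₁ : decomp (K := K) v) (hd₁ : (κ (d₁ : absoluteGaloisGroup K)).toAdd = (p : ℤ_[p]) ^ c)
    (hdiv : ∀ d : decomp (K := K) v, (p : ℤ_[p]) ^ c ∣ (κ (d : absoluteGaloisGroup K)).toAdd)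
    (hK : ∀ w₀ : InfinitePlace K, w₀.IsComplex) {k : ℕ} (hk : 0 < k) :
    ∃ m₀ : ℕ, ∀ m : ℕ, m₀ ≤ m → poitouTate_selmerStructure_duality (κ.layer m) →
      ∀ (T V : Finset (HeightOneSpectrum (𝓞 (κ.layer m)))), (∀ w, w ∈ V ↔ w.under (𝓞 K) = v) → Disjoint T V →
      Nat.card {a : W.geomPrimaryTorsion p //
          (∀ g : kerD κ v, ((g : decomp (K := K) v) : absoluteGaloisGroup K) • a = a) ∧ p ^ k • a = 0} ^ (p ^ c) =
      Nat.card ((kummerRelaxed (W.baseChange (κ.layer m)) (p ^ k)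
            ((T.image Sum.inr ∪ Finset.univ.image Sum.inl) ∪ V.image Sum.inr)).selmerGroup ⧸
          ((kummerRelaxed (W.baseChange (κ.layer m)) (p ^ k) (T.image Sum.inr ∪ Finset.univ.image Sum.inl)).selmerGroup).addSubgroupOf
            (kummerRelaxed (W.baseChange (κ.layer m)) (p ^ k)
              ((T.image Sum.inr ∪ Finset.univ.image Sum.inl) ∪ V.image Sum.inr)).selmerGroup) *
        Nat.card ((kummerStrict (W.baseChange (κ.layer m)) (p ^ k) (T.image Sum.inr ∪ Finset.univ.image Sum.inl)).selmerGroup ⧸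
          ((kummerStrict (W.baseChange (κ.layer m)) (p ^ k)
              ((T.image Sum.inr ∪ Finset.univ.image Sum.inl) ∪ V.image Sum.inr)).selmerGroup).addSubgroupOf
            (kummerStrict (W.baseChange (κ.layer m)) (p ^ k) (T.image Sum.inr ∪ Finset.univ.image Sum.inl)).selmerGroup) := by
  obtain ⟨m₀, hm₀⟩ := exists_forall_prod_natCard_kummerSelmerStructure_inr_layer_eq p κ v W hpv d₁ hd₁ hdiv k
  refine ⟨m₀, fun m hm hPT T V hV hTV ↦ ?_⟩
  have h1 := natCard_relaxedQuotient_mul_natCard_strictQuotient_eq (W.baseChange (κ.layer m)) p k hk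
      (isComplex_infinitePlace_layer κ hK m) hPT T V hTV
  rw [h1, hm₀ m hm V hV]

/-- **`#{θ : Fin p^c → H¹(kerD, A) // p^k • θ = 0} ≤ #(KO_m(T∪V∪∞)/KO_m(T∪∞)) · #(KS_m(T∪∞)/KS_m(T∪V∪∞))`** for `m ≥ m₀(k, c)`, `V` the places
of `K_m` above `v`, `T` disjoint from `V` — the previous identity with R3's local torsion count `#H¹(kerD, A)[p^k] ≤ #A^{kerD}[p^k]` (hypothesis
`hR3`, the registered R3 shape) and `#tuples[p^k] = (#H¹(kerD, A)[p^k])^{p^c}`. This is the left-hand end of step (f) of the relaxed count road: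
it remains to bound the two indices by the image count (c) and the dual term (d). [cite: MilneADT2006, Ch. I, Thm. 4.10 and Lemma 3.3]
[cite: GreenbergVatsal2000, §2 Prop. (2.4) and pp. 24–25] [cite: Washington1997, §13.1] -/
theorem exists_forall_natCard_tuples_le_pairCount (hpv : ((p : ℕ) : 𝓞 K) ∉ v.asIdeal) {c : ℕ}
    (d₁ : decomp (K := K) v) (hd₁ : (κ (d₁ : absoluteGaloisGroup K)).toAdd = (p : ℤ_[p]) ^ c)
    (hdiv : ∀ d : decomp (K := K) v, (p : ℤ_[p]) ^ c ∣ (κ (d : absoluteGaloisGroup K)).toAdd)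
    (hR3 : ∀ k : ℕ, Nat.card {f : Literature.NumberTheory.EllipticCurves.subgroupH1 (kerD κ v) (W.geomPrimaryTorsion p) //
        p ^ k • f = 0} ≤
      Nat.card {a : W.geomPrimaryTorsion p //
        (∀ g : kerD κ v, ((g : decomp (K := K) v) : absoluteGaloisGroup K) • a = a) ∧ p ^ k • a = 0})
    (hK : ∀ w₀ : InfinitePlace K, w₀.IsComplex) {k : ℕ} (hk : 0 < k) :
    ∃ m₀ : ℕ, ∀ m : ℕ, m₀ ≤ m → poitouTate_selmerStructure_duality (κ.layer m) →
      ∀ (T V : Finset (HeightOneSpectrum (𝓞 (κ.layer m)))), (∀ w, w ∈ V ↔ w.under (𝓞 K) = v) → Disjoint T V →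
      Nat.card {θ : Fin (p ^ c) → Literature.NumberTheory.EllipticCurves.subgroupH1 (kerD κ v) (W.geomPrimaryTorsion p) //
          p ^ k • θ = 0} ≤
      Nat.card ((kummerRelaxed (W.baseChange (κ.layer m)) (p ^ k)
            ((T.image Sum.inr ∪ Finset.univ.image Sum.inl) ∪ V.image Sum.inr)).selmerGroup ⧸
          ((kummerRelaxed (W.baseChange (κ.layer m)) (p ^ k) (T.image Sum.inr ∪ Finset.univ.image Sum.inl)).selmerGroup).addSubgroupOf
            (kummerRelaxed (W.baseChange (κ.layer m)) (p ^ k)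
              ((T.image Sum.inr ∪ Finset.univ.image Sum.inl) ∪ V.image Sum.inr)).selmerGroup) *
        Nat.card ((kummerStrict (W.baseChange (κ.layer m)) (p ^ k) (T.image Sum.inr ∪ Finset.univ.image Sum.inl)).selmerGroup ⧸
          ((kummerStrict (W.baseChange (κ.layer m)) (p ^ k)
              ((T.image Sum.inr ∪ Finset.univ.image Sum.inl) ∪ V.image Sum.inr)).selmerGroup).addSubgroupOf
            (kummerStrict (W.baseChange (κ.layer m)) (p ^ k) (T.image Sum.inr ∪ Finset.univ.image Sum.inl)).selmerGroup) := by
  obtain ⟨m₀, hm₀⟩ := exists_forall_pow_natCard_fixed_torsion_eq_pairCount p κ v W hpv d₁ hd₁ hdiv hK hk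
  refine ⟨m₀, fun m hm hPT T V hV hTV ↦ ?_⟩
  rw [← hm₀ m hm hPT T V hV hTV, natCard_fun_torsion_eq_pow]
  exact Nat.pow_le_pow_left (hR3 k) _


/-! ## §6 The finsets of places of `K_m` above `v` and above a finite set of places -/

section Finsets

variable {L : Type} [Field L] [NumberField L] [Algebra K L]

/-- The places of a finite extension `L ⊇ K` above a place `v` of `K` form a finset `V` with `w ∈ V ↔ w ∣ v`. [folklore] -/
theorem exists_finset_forall_mem_iff_under_eq (v : HeightOneSpectrum (𝓞 K)) :
    ∃ V : Finset (HeightOneSpectrum (𝓞 L)), ∀ w, w ∈ V ↔ w.under (𝓞 K) = v := by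
  have hfin : {w : HeightOneSpectrum (𝓞 L) | w.under (𝓞 K) = v}.Finite :=
    Set.finite_coe_iff.mp (finite_heightOneSpectrum_under_eq (M := L) v)
  exact ⟨hfin.toFinset, fun w ↦ by rw [Set.Finite.mem_toFinset, Set.mem_setOf_eq]⟩

/-- The places of `L ⊇ K` above a FINITE set `S` of places of `K` form a finset `T` with `w ∈ T ↔ (w ∩ K) ∈ S`. [folklore] -/
theorem exists_finset_forall_mem_iff_under_mem {S : Set (HeightOneSpectrum (𝓞 K))} (hS : S.Finite) :
    ∃ T : Finset (HeightOneSpectrum (𝓞 L)), ∀ w, w ∈ T ↔ w.under (𝓞 K) ∈ S := by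
  have hfin : {w : HeightOneSpectrum (𝓞 L) | w.under (𝓞 K) ∈ S}.Finite := by
    have h : {w : HeightOneSpectrum (𝓞 L) | w.under (𝓞 K) ∈ S} =
        ⋃ u ∈ S, {w : HeightOneSpectrum (𝓞 L) | w.under (𝓞 K) = u} := by
      ext w
      simp only [Set.mem_setOf_eq, Set.mem_iUnion, exists_prop, exists_eq_right']
    rw [h]
    exact hS.biUnion fun u _ ↦ Set.finite_coe_iff.mp (finite_heightOneSpectrum_under_eq (M := L) u)
  exact ⟨hfin.toFinset, fun w ↦ by rw [Set.Finite.mem_toFinset, Set.mem_setOf_eq]⟩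

omit [NumberField K] [NumberField L] in
/-- `T` (places above `S`) and `V` (places above `v`) are disjoint when `v ∉ S`. [folklore] -/
theorem disjoint_of_forall_mem_iff {S : Set (HeightOneSpectrum (𝓞 K))} {v : HeightOneSpectrum (𝓞 K)} (hv : v ∉ S)
    {T V : Finset (HeightOneSpectrum (𝓞 L))} (hT : ∀ w, w ∈ T ↔ w.under (𝓞 K) ∈ S)
    (hV : ∀ w, w ∈ V ↔ w.under (𝓞 K) = v) : Disjoint T V := by
  rw [Finset.disjoint_left]
  intro w hwT hwV
  exact hv ((hV w).mp hwV ▸ (hT w).mp hwT)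

end Finsets

end PairCount

end Summit.BirchSwinnertonDyer.BirchSwinnertonDyer.Theorems.UniversalToricDescentLayerKummerProduct

end
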